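import Literature.AlgebraicGeometry.Modules.DeterminantCocycleExact
import Literature.AlgebraicGeometry.Modules.RankOneCocycle
import HarnessLib

/-!
# [OURS · L1 W4.5(b) · EL♮(3) (L) brick C2, sub-brick B2′] Rank additivity on short exact sequences of vector bundles:
# `rk E₃ = rk E₂ − rk E₁` (and `rk E₂ = rk E₁ + rk E₃`, `rk E₁ = rk E₂ − rk E₃`) in the tree's `HasRank` currency

Cell res-hironaka, LADDER-RESOLUTION rung L, slot W4.5(b), crux chain w45b: EL♮(3) = stmt-ResolutionOfSingularities-20148, S6 (L) brick C2 of
`Tower.hLift_of_bricks` (res-L1-w45b-stub-4 skeleton; res-type-027 g15 C2-CENSUS f661334467642d74 §2, sub-brick B2 «Q-side classes» follow-up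
**B2′ «rank additivity»**: res-type-027 SIGS + ANSWERS 2026-08-27T23:33:53Z (b) «derive `HasRank (cokernel ι₀) 1` — add the rank-additivity lemma
`S.ShortExact → HasRank S.X₁ a → HasRank S.X₂ (a+b) → IsFiniteLocallyFree S.X₃ → HasRank S.X₃ b`, via `DeterminantCocycleExact` adapted frames»;
res-L1-w45b-plan-1 DEALS 2026-08-27T23:40:08Z (3)). Seat res-D-pv-036 g11 (on-call supplier). `--supports stmt-ResolutionOfSingularities-20148 --as
helper`. OURS; NOT a statement of any manuscript; AI-written, weaker than expert review. Definition-free; standard axioms.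

Currency (all tree): `HasRank E r` (`Motives/CrystallineRealization`: a locally free generators datum with all index sets of size `r`),
`IsFiniteLocallyFree` with its chosen frames `trivFrame hE x : 𝒪^{TrivIndex hE x} ≅ E|_{trivNbhd hE x}` (`Modules/LocallyFreeTrace`), frame systems
`FrameSystem` (`Modules/DeterminantCocycle`, `Modules/RankOneCocycle`: `exists_frameSystem_of_hasRank`, `FrameSystem.hasRank`), the invariant
basis number over a non-empty open `rank_eq_of_nontrivial` (`Modules/FrameTransition`), and the adapted frame system of the middle term of a short
exact sequence `adaptedFrameSystem hS h₁ h₃ : FrameSystem S.X₂` of size `#TrivIndex h₁ x + #TrivIndex h₃ x` at `x` (`Modules/DeterminantCocycleExact`).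

* `rank_eq_of_hasRank_of_frame` — any frame `𝒪^I_W ≅ E|_W`, `I ≃ Fin n`, of a module of rank `r` at a point of `W` has `n = r`;
  `natCard_trivIndex_eq_of_hasRank` — the chosen frames of a module of rank `r` have size `r`; `hasRank_of_natCard_trivIndex_eq` — conversely;
  `isFiniteLocallyFree_of_hasRank`.
* **`hasRank_X₃_of_shortExact`** (B2′ as dealt) — `0 → E₁ → E₂ → E₃ → 0` short exact, `rk E₁ = a`, `rk E₂ = a + b`, `E₃` finite locally free
  `⇒ rk E₃ = b`; `hasRank_X₂_of_shortExact` (`rk E₂ = a + b` from `rk E₁ = a`, `rk E₃ = b`); `hasRank_X₁_of_shortExact`;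
  `hasRank_X₃_one_of_shortExact` (the C2 instance: `rk L₀ = 1`, `rk F = 2` `⇒ rk Q = 1`).
[cite: Hartshorne1977, II Ex. 5.16 (d), II §5] [folklore]
-/

noncomputable section

open CategoryTheory AlgebraicGeometry Opposite TopologicalSpace
open Literature.AlgebraicGeometry.Modules Literature.AlgebraicGeometry.Motives

set_option linter.dupNamespace false

namespace Summit.ResolutionOfSingularities.ResolutionOfSingularities.Cruxes.EquisingularLiftNat.Sections

universe u

variable {X : Scheme.{u}}

/-- The sections of a scheme over an open containing a point form a nonzero ring (`D(1) = W ≠ ⊥ = D(0)`; cf. tree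
`Motives/SmoothSpread.nontrivial_sections_of_mem`, reproved here to keep the imports of this file inside `Modules/`). [folklore] -/
private theorem nontrivial_sections_of_mem_aux {W : X.Opens} {x : X} (hx : x ∈ W) : Nontrivial Γ(X, W) := by
  refine ⟨⟨0, 1, fun h01 => ?_⟩⟩
  have h1 : X.basicOpen (1 : Γ(X, W)) = W := X.basicOpen_of_isUnit isUnit_one
  rw [← h01, X.basicOpen_zero W] at h1
  rw [← h1] at hx
  exact hx

/-- **Frames of a module of rank `r` have size `r`**: if `E` has rank `r` and `e : 𝒪^I_W ≅ E|_W` is a frame with `I ≃ Fin n` over an open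
`W` containing a point, then `n = r` (invariant basis number over the non-zero ring `Γ(X, W ∩ U_x)`, `U_x` a member of a rank-`r` frame system).
[cite: Hartshorne1977, II §5] [folklore] -/
theorem rank_eq_of_hasRank_of_frame {E : X.Modules} {r : ℕ} (h : HasRank E r) {W : X.Opens} {I : Type u} {n : ℕ}
    (e : SheafOfModules.free I ≅ E.over W) (ε : I ≃ Fin n) {x : X} (hx : x ∈ W) : n = r := by
  obtain ⟨F, hF⟩ := exists_frameSystem_of_hasRank h
  haveI := nontrivial_sections_of_mem_aux (X := X) (W := W ⊓ F.U x) ⟨hx, F.mem x⟩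
  rw [← hF x]
  exact rank_eq_of_nontrivial e (F.frame x) ε (F.enum x) (homOfLE inf_le_left) (homOfLE inf_le_right)

/-- The chosen frames `trivFrame hE x` of a finite locally free module of rank `r` have size `r`: `#TrivIndex hE x = r`.
[cite: Hartshorne1977, II §5] [folklore] -/
theorem natCard_trivIndex_eq_of_hasRank {E : X.Modules} (hE : IsFiniteLocallyFree E) {r : ℕ} (h : HasRank E r) (x : X) :
    Nat.card (TrivIndex hE x) = r :=
  rank_eq_of_hasRank_of_frame h (trivFrame hE x) (Finite.equivFin _) (mem_trivNbhd hE x)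

/-- A finite locally free module all of whose chosen frames have size `r` has rank `r`. [cite: Hartshorne1977, II §5] [folklore] -/
theorem hasRank_of_natCard_trivIndex_eq {E : X.Modules} (hE : IsFiniteLocallyFree E) {r : ℕ}
    (h : ∀ x, Nat.card (TrivIndex hE x) = r) : HasRank E r :=
  FrameSystem.hasRank
    { U := trivNbhd hE
      mem := mem_trivNbhd hE
      I := TrivIndex hE
      rank := fun _ => r
      enum := fun x => (Finite.equivFin _).trans (finCongr (h x))
      frame := trivFrame hE } r fun _ => rfl

/-- A module of (constant) rank `r` is finite locally free. [folklore] -/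
theorem isFiniteLocallyFree_of_hasRank {E : X.Modules} {r : ℕ} (h : HasRank E r) : IsFiniteLocallyFree E := by
  obtain ⟨F, -⟩ := exists_frameSystem_of_hasRank h
  exact F.isFiniteLocallyFree

/-- The adapted frame of `E₂` at `x` has size `#TrivIndex h₁ x + #TrivIndex h₃ x`; if `E₂` has rank `n` this is `n`. [folklore] -/
theorem natCard_trivIndex_add_eq_of_shortExact {S : ShortComplex X.Modules} (hS : S.ShortExact) (h₁ : IsFiniteLocallyFree S.X₁)
    (h₃ : IsFiniteLocallyFree S.X₃) {n : ℕ} (h₂ : HasRank S.X₂ n) (x : X) :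
    Nat.card (TrivIndex h₁ x) + Nat.card (TrivIndex h₃ x) = n :=
  rank_eq_of_hasRank_of_frame h₂ ((adaptedFrameSystem hS h₁ h₃).frame x) ((adaptedFrameSystem hS h₁ h₃).enum x)
    ((adaptedFrameSystem hS h₁ h₃).mem x)

/-- **B2′ (rank additivity, as dealt): `rk E₃ = rk E₂ − rk E₁`.** For a short exact sequence `0 → E₁ → E₂ → E₃ → 0` of `𝒪_X`-modules with
`E₁` of rank `a`, `E₂` of rank `a + b` and `E₃` finite locally free, `E₃` has rank `b` (adapted frames of `E₂` have size `#I₁ₓ + #I₃ₓ = a + b` and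
`#I₁ₓ = a`). [cite: Hartshorne1977, II Ex. 5.16 (d), II §5] [folklore] -/
theorem hasRank_X₃_of_shortExact {S : ShortComplex X.Modules} (hS : S.ShortExact) {a b : ℕ} (h₁ : HasRank S.X₁ a)
    (h₂ : HasRank S.X₂ (a + b)) (h₃ : IsFiniteLocallyFree S.X₃) : HasRank S.X₃ b := by
  have h₁f : IsFiniteLocallyFree S.X₁ := isFiniteLocallyFree_of_hasRank h₁
  refine hasRank_of_natCard_trivIndex_eq h₃ fun x => ?_
  have e₂ := natCard_trivIndex_add_eq_of_shortExact hS h₁f h₃ h₂ x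
  have e₁ := natCard_trivIndex_eq_of_hasRank h₁f h₁ x
  omega

/-- **`rk E₂ = rk E₁ + rk E₃`**: for `0 → E₁ → E₂ → E₃ → 0` short exact with `E₁` of rank `a` and `E₃` of rank `b`, `E₂` has rank `a + b`.
[cite: Hartshorne1977, II Ex. 5.16 (d), II §5] [folklore] -/
theorem hasRank_X₂_of_shortExact {S : ShortComplex X.Modules} (hS : S.ShortExact) {a b : ℕ} (h₁ : HasRank S.X₁ a)
    (h₃ : HasRank S.X₃ b) : HasRank S.X₂ (a + b) := by
  have h₁f : IsFiniteLocallyFree S.X₁ := isFiniteLocallyFree_of_hasRank h₁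
  have h₃f : IsFiniteLocallyFree S.X₃ := isFiniteLocallyFree_of_hasRank h₃
  refine (adaptedFrameSystem hS h₁f h₃f).hasRank (a + b) fun x => ?_
  show Nat.card (TrivIndex h₁f x) + Nat.card (TrivIndex h₃f x) = a + b
  rw [natCard_trivIndex_eq_of_hasRank h₁f h₁ x, natCard_trivIndex_eq_of_hasRank h₃f h₃ x]

/-- **`rk E₁ = rk E₂ − rk E₃`**: for `0 → E₁ → E₂ → E₃ → 0` short exact with `E₁` finite locally free, `E₂` of rank `a + b` and `E₃` of rank
`b`, `E₁` has rank `a`. [cite: Hartshorne1977, II Ex. 5.16 (d), II §5] [folklore] -/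
theorem hasRank_X₁_of_shortExact {S : ShortComplex X.Modules} (hS : S.ShortExact) {a b : ℕ} (h₁ : IsFiniteLocallyFree S.X₁)
    (h₂ : HasRank S.X₂ (a + b)) (h₃ : HasRank S.X₃ b) : HasRank S.X₁ a := by
  have h₃f : IsFiniteLocallyFree S.X₃ := isFiniteLocallyFree_of_hasRank h₃
  refine hasRank_of_natCard_trivIndex_eq h₁ fun x => ?_
  have e₂ := natCard_trivIndex_add_eq_of_shortExact hS h₁ h₃f h₂ x
  have e₃ := natCard_trivIndex_eq_of_hasRank h₃f h₃ x
  omega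

/-- **The C2 instance: `rk L₀ = 1`, `rk F = 2`, `Q` finite locally free `⇒ rk Q = 1`** for `0 → L₀ → F → Q → 0` short exact (feeds B2
`detClass_sheafHom_eq_of_shortExact` / K1, which want `HasRank Q 1`). [cite: Hartshorne1977, II Ex. 5.16 (d), II §5] [folklore] -/
theorem hasRank_X₃_one_of_shortExact {S : ShortComplex X.Modules} (hS : S.ShortExact) (h₁ : HasRank S.X₁ 1) (h₂ : HasRank S.X₂ 2)
    (h₃ : IsFiniteLocallyFree S.X₃) : HasRank S.X₃ 1 :=
  hasRank_X₃_of_shortExact hS (a := 1) (b := 1) h₁ h₂ h₃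

end Summit.ResolutionOfSingularities.ResolutionOfSingularities.Cruxes.EquisingularLiftNat.Sections

end
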